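import Summits.BirchSwinnertonDyer.BirchSwinnertonDyer.Theorems.GoldfeldAllTwistsTwoConverseTwinAdditiveInertTwistDescent
import Summits.BirchSwinnertonDyer.BirchSwinnertonDyer.Theorems.EisensteinDepletionAtTwoFamily81517Rank3Cert
import HarnessLib

set_option linter.dupNamespace false -- namespace `…BirchSwinnertonDyer.BirchSwinnertonDyer…` is the cell's (D-0017 nested layout)
set_option autoImplicit false

/-!
# Cells C1 (`(p/q) = −1`, `q ≡ 3 (8)`, type α, `p ≡ 1 (8)`) and C2 (same with `p ≡ 5 (8)`) of the two-prime family `W ≅ 49a1^{(−2qp)}` each carry a member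
# of Mordell–Weil rank `≥ 3`, CERTIFIED IN THE KERNEL: `(q, p) = (19, 337)` and `(19, 37)` — `3 ≤ rank W(ℚ)` for every `W ≅ 49a1^{(−12806)}` and every
# `W ≅ 49a1^{(−1406)}` (fact-free explicit descent via `2`-isogeny)

Cell `bsd-goldfeld`, seat `bsd-goldfeld-s1p-c3x` (gen 21); planner RULING (cdxxxiii), OBJECT 9 «NON-SHARP RANK-THREE KERNEL CERTIFICATES».
`--supports stmt-BirchSwinnertonDyer-20044` as a HELPER (rank axis): a TIGHTNESS / OBSTRUCTION certificate, not a closer. Theses-free; theorems only;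
no definition, no named-fact binder (`variable`/`include` = 0), no `sorry`; every numerical claim is re-verified by the kernel.

THE FAMILY AND ITS SIXTEEN CELLS (capstone `…TwinQuarterTraceSharpLocusUnion` (R p725669), §0 `twoPrimes_sharpLocus_or_nonSharp`): primes `q > 3`,
`q ≡ 3 (mod 4)`, `(q/7) = −1`, and `p ≡ 1 (mod 4)`, `(−7/p) = +1`; type β ⟺ `−7` is a fourth power mod `p` (else type α). On TWELVE cells the
capstone proves `r_an(W) = rank W(ℚ) = 1 ∧ Ш(W)` finite for EVERY `W ≅ 49a1^{(−2qp)}` (modulo SEVENTEEN named prints); its hypothesis `hcell`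
excludes exactly C1 (`(p/q) = −1`, `q ≡ 3 (8)`, α, `p ≡ 1 (8)`), C2 (same with `p ≡ 5 (8)`), b31+ (`(p/q) = +1`, β, `p ≡ 1 (8)`, `q ≡ 3 (8)`),
b71+ (same with `q ≡ 7 (8)`) — the cells where the `2`-isogeny Selmer pair of `W` is `(4, 8)` — and its docstrings record rank-`3` members there
as PARI NUMERICS («not kernel»). OBJECT 9 makes them THEOREMS, one witness per cell — `(q,p) = (19,337)` [C1] and `(19,37)` [C2] (file
`…TwinNonSharpRankThreeC1C2`), `(139,193)` [b31+] and `(311,193)` [b71+] (file `…TwinNonSharpRankThreeB31B71`), and the NEGATIONS «the capstone's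
`hcell` cannot be dropped, cell by cell and as a whole» (file `…TwinNonSharpRankThree`). The gate's 400-line lint splits the object into three files.

METHOD (fact-free; the tree's explicit descent via `2`-isogeny — the planted-rank kernel `Summits/BirchSwinnertonDyer/Rank2/TwoIsogenyPlantedRankKernel.lean`
(`add_le_mordellWeilRank_add_two_of_card_le`: `2^i` classes in `α(E(ℚ))` and `2^j` in `ᾱ(E′(ℚ))` ⇒ `i + j ≤ rank + 2`, from
`WeierstrassCurve.natCard_range_xSqClass_mul` = Silverman–Tate §3.6 with the tree's Mordell–Weil theorem) and the helpers of the accepted rank-`3`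
certificate `…Theorems/EisensteinDepletionAtTwoFamily81517Rank3Cert.lean`): on the two-torsion model `E = E_{a,b} = [0, −42qp, 0, 448q²p², 0]`
(`= (⟨(mk0 2)⁻¹, 2d, 0, 0⟩ * C) • W` for `C • W = cm7^{(d)}`, `d = −2qp`, `smul_eq_twoTorsionModel_of_smul_eq_quadraticTwist`) and its `2`-isogenous
curve `E′ = [0, 84qp, 0, −28q²p², 0]`, explicit rational points give FOUR square classes in `α(E(ℚ))` and EIGHT in `ᾱ(E′(ℚ))` (`α = xSqClass`,
Silverman–Tate §3.5), so `3 ≤ rank E(ℚ)`, transported to every model `W` by `mordellWeilRank_variableChange_holds`. The upper bound `rank ≤ 3`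
(`#S = 4`, `#S′ = 8`; PARI `ellrank = [3, 3, 0]`) is NOT re-proved; only the lower bound is used. Points: PARI/GP 2.17 `ellrank` + `ellsaturation`,
kit j333313 (`rank3.gp`); every claim below is re-verified by the kernel (`norm_num`).

THIS FILE: §1 the witness `(19,337)` [C1], §2 the witness `(19,37)` [C2] — each: `isElliptic`, four classes in `α(E(ℚ))`, eight in `ᾱ(E′(ℚ))`,
`3 ≤ rank E(ℚ)`, and the transport `3 ≤ rank W(ℚ)` for every model `W`.

HONEST FRAMING: a tightness / obstruction certificate on explicit twists inside twist-density-ZERO cells; it certifies that NO cell-uniform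
rank-one statement extends the capstone to C1 / C2 / b31+ / b71+ and changes NO width (C1/C2, b31+/b71+ remain director width — this certifies why);
it says nothing about the cells' rank-one members (where the quarter-point device is silent, memo `HOME/NONSHARP-CHIZ-VANISHING.md`), nothing about
`r_an` (PARI's `r_an = 3` stays numerics) and nothing about density; not a closer of any item; items 19350 / 20044 / 19140 SUPPORT only and unchanged;
BSD is not proved by any of this.

References: [SilvermanTate2015] §3.5 (the map `α`), §3.6 (`2^r = #α(Γ)·#ᾱ(Γ̄)/4`); [SilvermanAEC2009] III.3.1(b), VIII.6, Prop. X.4.9, Example X.4.10.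
-/

noncomputable section

open scoped Classical

open WeierstrassCurve Literature.NumberTheory.EllipticCurves
open WeierstrassCurve.Affine (SqUnits sqClass sqClass_mul sqClass_sq sqClass_eq_one_iff)
open Summit.BirchSwinnertonDyer.Rank2 (add_le_mordellWeilRank_add_two_of_card_le eq_of_sqClass_intCast_eq sqClass_mul_sq_intCast)
open Summit.BirchSwinnertonDyer.BirchSwinnertonDyer.Theorems.Family81517Rank3Cert (nonsingular_of_eq sqClass_mem_range_of_eq)

namespace Summit.BirchSwinnertonDyer.BirchSwinnertonDyer.Theorems.GoldfeldGoodTwists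

/-- Squarefreeness of a (small) integer from the factorisation of its absolute value. [cite: SilvermanTate2015, §3.5] -/
private theorem squarefree_int_of_natAbs {d : ℤ} {n : ℕ} (h : d.natAbs = n) (hn : n ≠ 0)
    (hnd : n.primeFactorsList.Nodup) : Squarefree d :=
  Int.squarefree_natAbs.mp (h ▸ (Nat.squarefree_iff_nodup_primeFactorsList hn).mpr hnd)

/-! ## §1 Cell C1 (`(p/q) = −1`, `q ≡ 3 (8)`, type α, `p ≡ 1 (8)`): the witness `(q, p) = (19, 337)`, `W ≅ 49a1^{(−12806)}`,
two-torsion model `E = [0, -268926, 0, 18367287232, 0]`, isogenous curve `E′ = [0, 537852, 0, -1147955452, 0]` -/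
section Witness_19_337

/-- `b (a² − 4b) ≠ 0` for `(a, b) = (-268926, 18367287232)`. [cite: SilvermanAEC2009, Prop. X.4.9] -/
private theorem hab_19_337 : (18367287232 : ℤ) * ((-268926 : ℤ) ^ 2 - 4 * (18367287232)) ≠ 0 := by norm_num

/-- `E = [0, -268926, 0, 18367287232, 0]` is an elliptic curve. [cite: SilvermanAEC2009, Prop. X.4.9] -/
theorem isElliptic_E_19_337 : (⟨0, -268926, 0, 18367287232, 0⟩ : WeierstrassCurve ℚ).IsElliptic := by
  rw [show (⟨0, -268926, 0, 18367287232, 0⟩ : WeierstrassCurve ℚ) = ⟨0, ((-268926 : ℤ) : ℚ), 0, ((18367287232 : ℤ) : ℚ), 0⟩ by ext <;> push_cast <;> ring]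
  exact isElliptic_mk_of_ne_zero (F := ℚ) hab_19_337

/-- `E′ = [0, 537852, 0, -1147955452, 0]` is an elliptic curve. [cite: SilvermanAEC2009, Prop. X.4.9] -/
theorem isElliptic_E'_19_337 : (⟨0, 537852, 0, -1147955452, 0⟩ : WeierstrassCurve ℚ).IsElliptic := by
  rw [show (⟨0, 537852, 0, -1147955452, 0⟩ : WeierstrassCurve ℚ) = ⟨0, ((-2 * (-268926) : ℤ) : ℚ), 0, (((-268926 : ℤ) ^ 2 - 4 * (18367287232) : ℤ) : ℚ), 0⟩ by
    ext <;> push_cast <;> ring]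
  exact isElliptic_mk_of_ne_zero (F := ℚ) (twoIsogenyCodomain_ne_zero hab_19_337)

/-- **Four classes in `α(E(ℚ))`**, `E = [0, -268926, 0, 18367287232, 0]` (`49a1^{(−12806)}`): `[1]`, `α(T) = [18367287232] = [7]`, `α(128124704 / 841, -234508173824 / 24389) = [674]` and the product — the classes of `[1, 7, 674, 4718]` (point: kit j333313, PARI `ellrank` + `ellsaturation`). [cite: SilvermanTate2015, §3.5–§3.6] -/
theorem four_classes_E_19_337 :
    ∃ S : Finset (SqUnits ℚ), (S : Set (SqUnits ℚ)) ⊆ Set.range (⟨0, -268926, 0, 18367287232, 0⟩ : WeierstrassCurve ℚ).xSqClass ∧ S.card = 4 := by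
  haveI := isElliptic_E_19_337
  set W := (⟨0, -268926, 0, 18367287232, 0⟩ : WeierstrassCurve ℚ) with hW
  have hs1 : sqClass (((1 : ℤ)) : ℚ) ∈ Set.range W.xSqClass :=
    ⟨0, by rw [xSqClass_zero, Int.cast_one]; exact ((sqClass_eq_one_iff one_ne_zero).mpr ⟨1, by norm_num⟩).symm⟩
  have hs7 : sqClass (((7 : ℤ)) : ℚ) ∈ Set.range W.xSqClass := by
    refine ⟨W.twoTorsionPoint, ?_⟩
    rw [xSqClass_twoTorsionPoint, show W.a₄ = (((7 * 51224 ^ 2 : ℤ)) : ℚ) by rw [hW]; norm_num,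
      sqClass_mul_sq_intCast (by norm_num) (by norm_num)]
  have hs674 : sqClass (((674 : ℤ)) : ℚ) ∈ Set.range W.xSqClass := by
    have h := sqClass_mem_range_of_eq (a := -268926) (b := 18367287232) (x := (128124704 / 841)) (y := (-234508173824 / 24389)) (by norm_num) (by norm_num)
    rwa [show (128124704 / 841 : ℚ) = 674 * ((436 / 29)) ^ 2 by norm_num, sqClass_mul (by norm_num) (by norm_num), sqClass_sq, mul_one,
      show (674 : ℚ) = ((674 : ℤ) : ℚ) by norm_num] at h
  have hs4718 : sqClass (((4718 : ℤ)) : ℚ) ∈ Set.range W.xSqClass := by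
    have h := mul_mem_range_xSqClass W hs7 hs674
    rwa [← sqClass_mul (by norm_num) (by norm_num), ← Int.cast_mul, show ((7 : ℤ) * 674 : ℤ) = 4718 by norm_num] at h
  have hsqf : ∀ d ∈ ({1, 7, 674, 4718} : Finset ℤ), Squarefree d := by
    intro d hd
    simp only [Finset.mem_insert, Finset.mem_singleton] at hd
    rcases hd with rfl | rfl | rfl | rfl <;> exact squarefree_int_of_natAbs rfl (by norm_num) (by simp)
  refine ⟨({1, 7, 674, 4718} : Finset ℤ).image fun d : ℤ => sqClass (d : ℚ), ?_, ?_⟩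
  · intro c hc
    obtain ⟨d, hd, rfl⟩ := Finset.mem_image.mp (Finset.mem_coe.mp hc)
    simp only [Finset.mem_insert, Finset.mem_singleton] at hd
    rcases hd with rfl | rfl | rfl | rfl <;> assumption
  · rw [Finset.card_image_of_injOn (fun d₁ h₁ d₂ h₂ he => eq_of_sqClass_intCast_eq (hsqf d₁ h₁) (hsqf d₂ h₂) he)]
    rfl

/-- **Eight classes in `ᾱ(E′(ℚ))`**, `E′ = [0, 537852, 0, -1147955452, 0]`: `[1]`, `ᾱ(T′) = [-1147955452] = [−7]`, `ᾱ(-2359, 2384949) = [-2359]`; `ᾱ(-319214, -150482976) = [-14]` and the products — the classes of `[1, -7, -2359, -14, 337, 2, 674, -4718]` (points: kit j333313). [cite: SilvermanTate2015, §3.5–§3.6] -/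
theorem eight_classes_E'_19_337 :
    ∃ S : Finset (SqUnits ℚ), (S : Set (SqUnits ℚ)) ⊆ Set.range (⟨0, 537852, 0, -1147955452, 0⟩ : WeierstrassCurve ℚ).xSqClass ∧ S.card = 8 := by
  haveI := isElliptic_E'_19_337
  set W := (⟨0, 537852, 0, -1147955452, 0⟩ : WeierstrassCurve ℚ) with hW
  have hs1 : sqClass (((1 : ℤ)) : ℚ) ∈ Set.range W.xSqClass :=
    ⟨0, by rw [xSqClass_zero, Int.cast_one]; exact ((sqClass_eq_one_iff one_ne_zero).mpr ⟨1, by norm_num⟩).symm⟩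
  have hsm7 : sqClass (((-7 : ℤ)) : ℚ) ∈ Set.range W.xSqClass := by
    refine ⟨W.twoTorsionPoint, ?_⟩
    rw [xSqClass_twoTorsionPoint, show W.a₄ = (((-7 * 12806 ^ 2 : ℤ)) : ℚ) by rw [hW]; norm_num,
      sqClass_mul_sq_intCast (by norm_num) (by norm_num)]
  have hsm2359 : sqClass (((-2359 : ℤ)) : ℚ) ∈ Set.range W.xSqClass := by
    have h := sqClass_mem_range_of_eq (a := 537852) (b := -1147955452) (x := (-2359)) (y := 2384949) (by norm_num) (by norm_num)
    rwa [show (-2359 : ℚ) = ((-2359 : ℤ) : ℚ) by norm_num] at h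
  have hsm14 : sqClass (((-14 : ℤ)) : ℚ) ∈ Set.range W.xSqClass := by
    have h := sqClass_mem_range_of_eq (a := 537852) (b := -1147955452) (x := (-319214)) (y := (-150482976)) (by norm_num) (by norm_num)
    rwa [show (-319214 : ℚ) = -14 * (151) ^ 2 by norm_num, sqClass_mul (by norm_num) (by norm_num), sqClass_sq, mul_one,
      show (-14 : ℚ) = ((-14 : ℤ) : ℚ) by norm_num] at h
  have hs337 : sqClass (((337 : ℤ)) : ℚ) ∈ Set.range W.xSqClass := by
    have h := mul_mem_range_xSqClass W hsm7 hsm2359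
    rwa [← sqClass_mul (by norm_num) (by norm_num), ← Int.cast_mul, show ((-7 : ℤ) * -2359 : ℤ) = 337 * 7 ^ 2 by norm_num,
      sqClass_mul_sq_intCast (by norm_num) (by norm_num)] at h
  have hs2 : sqClass (((2 : ℤ)) : ℚ) ∈ Set.range W.xSqClass := by
    have h := mul_mem_range_xSqClass W hsm7 hsm14
    rwa [← sqClass_mul (by norm_num) (by norm_num), ← Int.cast_mul, show ((-7 : ℤ) * -14 : ℤ) = 2 * 7 ^ 2 by norm_num,
      sqClass_mul_sq_intCast (by norm_num) (by norm_num)] at h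
  have hs674 : sqClass (((674 : ℤ)) : ℚ) ∈ Set.range W.xSqClass := by
    have h := mul_mem_range_xSqClass W hsm2359 hsm14
    rwa [← sqClass_mul (by norm_num) (by norm_num), ← Int.cast_mul, show ((-2359 : ℤ) * -14 : ℤ) = 674 * 7 ^ 2 by norm_num,
      sqClass_mul_sq_intCast (by norm_num) (by norm_num)] at h
  have hsm4718 : sqClass (((-4718 : ℤ)) : ℚ) ∈ Set.range W.xSqClass := by
    have h := mul_mem_range_xSqClass W hs337 hsm14
    rwa [← sqClass_mul (by norm_num) (by norm_num), ← Int.cast_mul, show ((337 : ℤ) * -14 : ℤ) = -4718 by norm_num] at h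
  have hsqf : ∀ d ∈ ({1, -7, -2359, -14, 337, 2, 674, -4718} : Finset ℤ), Squarefree d := by
    intro d hd
    simp only [Finset.mem_insert, Finset.mem_singleton] at hd
    rcases hd with rfl | rfl | rfl | rfl | rfl | rfl | rfl | rfl <;> exact squarefree_int_of_natAbs rfl (by norm_num) (by simp)
  refine ⟨({1, -7, -2359, -14, 337, 2, 674, -4718} : Finset ℤ).image fun d : ℤ => sqClass (d : ℚ), ?_, ?_⟩
  · intro c hc
    obtain ⟨d, hd, rfl⟩ := Finset.mem_image.mp (Finset.mem_coe.mp hc)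
    simp only [Finset.mem_insert, Finset.mem_singleton] at hd
    rcases hd with rfl | rfl | rfl | rfl | rfl | rfl | rfl | rfl <;> assumption
  · rw [Finset.card_image_of_injOn (fun d₁ h₁ d₂ h₂ he => eq_of_sqClass_intCast_eq (hsqf d₁ h₁) (hsqf d₂ h₂) he)]
    rfl

/-- **`3 ≤ rank E(ℚ)`** for `E = [0, -268926, 0, 18367287232, 0]`, the two-torsion model of `49a1^{(−12806)}`, FACT-FREE: four classes in `α(E(ℚ))`, eight in `ᾱ(E′(ℚ))`, and `#α·#ᾱ = 2^{rank+2}` (the tree's `natCard_range_xSqClass_mul`, Silverman–Tate §3.6, through the planted-rank kernel `Rank2.add_le_mordellWeilRank_add_two_of_card_le`: `2 + 3 ≤ rank + 2`). PARI's `ellrank` returns `[3, 3, 0]` (rank exactly `3`); the upper bound is not re-proved here. [cite: SilvermanTate2015, §3.6 (2^r = #α(Γ)·#ᾱ(Γ̄)/4)] -/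
theorem three_le_mordellWeilRank_E_19_337 : 3 ≤ (⟨0, -268926, 0, 18367287232, 0⟩ : WeierstrassCurve ℚ).mordellWeilRank := by
  haveI := isElliptic_E_19_337
  obtain ⟨S, hS, hS4⟩ := four_classes_E_19_337
  obtain ⟨S', hS', hS8⟩ := eight_classes_E'_19_337
  have hcod : (⟨0, -268926, 0, 18367287232, 0⟩ : WeierstrassCurve ℚ).twoIsogenyCodomain = ⟨0, 537852, 0, -1147955452, 0⟩ := by
    simp only [twoIsogenyCodomain]; norm_num
  rw [← hcod] at hS'
  have h := add_le_mordellWeilRank_add_two_of_card_le _ hS hS' (i := 2) (j := 3) (by rw [hS4]; norm_num) (by rw [hS8]; norm_num)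
  omega

/-- **`3 ≤ rank W(ℚ)` for EVERY model `W` of `49a1^{(−2·19·337)}`** (`C • W = cm7^{(−12806)}` in the capstone's spelling `−(2·q·p)`, `q p : ℕ`): the two-torsion model `E = [0, -268926, 0, 18367287232, 0]` is `(⟨(mk0 2)⁻¹, 2d, 0, 0⟩ * C) • W` (the lane's `smul_eq_twoTorsionModel_of_smul_eq_quadraticTwist`, `d = −12806`, as in `rank_le_one_and_sha_two_twoPrimesTwist`) and the rank is invariant under the change of variables (`mordellWeilRank_variableChange_holds`). [cite: SilvermanAEC2009, III.3.1(b) and VIII.6] [cite: SilvermanTate2015, §3.6] -/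
theorem three_le_mordellWeilRank_twoPrimesTwist_19_337 (W : WeierstrassCurve ℚ) [W.IsElliptic] (C : VariableChange ℚ)
    (hC : C • W = cm7.quadraticTwist (-(2 * ((19 : ℕ) : ℚ) * ((337 : ℕ) : ℚ)))) : 3 ≤ W.mordellWeilRank := by
  have hC' : C • W = cm7.quadraticTwist (((-12806 : ℤ)) : ℚ) := by
    rw [hC]; congr 1; push_cast; norm_num
  have hE := (smul_eq_twoTorsionModel_of_smul_eq_quadraticTwist (-12806) W C hC').trans
    (show (⟨0, ((21 * (-12806) : ℤ) : ℚ), 0, ((112 * (-12806) ^ 2 : ℤ) : ℚ), 0⟩ : WeierstrassCurve ℚ) = ⟨0, -268926, 0, 18367287232, 0⟩ by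
      ext <;> push_cast <;> norm_num)
  have hrk := mordellWeilRank_variableChange_holds W
    ((⟨(Units.mk0 (2 : ℚ) two_ne_zero)⁻¹, 2 * (((-12806 : ℤ)) : ℚ), 0, 0⟩ : VariableChange ℚ) * C)
  unfold mordellWeilRank_variableChange at hrk
  rw [← hrk, hE]
  exact three_le_mordellWeilRank_E_19_337

end Witness_19_337

/-! ## §2 Cell C2 (`(p/q) = −1`, `q ≡ 3 (8)`, type α, `p ≡ 5 (8)`): the witness `(q, p) = (19, 37)`, `W ≅ 49a1^{(−1406)}`,
two-torsion model `E = [0, -29526, 0, 221405632, 0]`, isogenous curve `E′ = [0, 59052, 0, -13837852, 0]` -/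
section Witness_19_37

/-- `b (a² − 4b) ≠ 0` for `(a, b) = (-29526, 221405632)`. [cite: SilvermanAEC2009, Prop. X.4.9] -/
private theorem hab_19_37 : (221405632 : ℤ) * ((-29526 : ℤ) ^ 2 - 4 * (221405632)) ≠ 0 := by norm_num

/-- `E = [0, -29526, 0, 221405632, 0]` is an elliptic curve. [cite: SilvermanAEC2009, Prop. X.4.9] -/
theorem isElliptic_E_19_37 : (⟨0, -29526, 0, 221405632, 0⟩ : WeierstrassCurve ℚ).IsElliptic := by
  rw [show (⟨0, -29526, 0, 221405632, 0⟩ : WeierstrassCurve ℚ) = ⟨0, ((-29526 : ℤ) : ℚ), 0, ((221405632 : ℤ) : ℚ), 0⟩ by ext <;> push_cast <;> ring]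
  exact isElliptic_mk_of_ne_zero (F := ℚ) hab_19_37

/-- `E′ = [0, 59052, 0, -13837852, 0]` is an elliptic curve. [cite: SilvermanAEC2009, Prop. X.4.9] -/
theorem isElliptic_E'_19_37 : (⟨0, 59052, 0, -13837852, 0⟩ : WeierstrassCurve ℚ).IsElliptic := by
  rw [show (⟨0, 59052, 0, -13837852, 0⟩ : WeierstrassCurve ℚ) = ⟨0, ((-2 * (-29526) : ℤ) : ℚ), 0, (((-29526 : ℤ) ^ 2 - 4 * (221405632) : ℤ) : ℚ), 0⟩ by
    ext <;> push_cast <;> ring]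
  exact isElliptic_mk_of_ne_zero (F := ℚ) (twoIsogenyCodomain_ne_zero hab_19_37)

/-- **Four classes in `α(E(ℚ))`**, `E = [0, -29526, 0, 221405632, 0]` (`49a1^{(−1406)}`): `[1]`, `α(T) = [221405632] = [7]`, `α(8288, 613312) = [518]` and the product — the classes of `[1, 7, 518, 74]` (point: kit j333313, PARI `ellrank` + `ellsaturation`). [cite: SilvermanTate2015, §3.5–§3.6] -/
theorem four_classes_E_19_37 :
    ∃ S : Finset (SqUnits ℚ), (S : Set (SqUnits ℚ)) ⊆ Set.range (⟨0, -29526, 0, 221405632, 0⟩ : WeierstrassCurve ℚ).xSqClass ∧ S.card = 4 := by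
  haveI := isElliptic_E_19_37
  set W := (⟨0, -29526, 0, 221405632, 0⟩ : WeierstrassCurve ℚ) with hW
  have hs1 : sqClass (((1 : ℤ)) : ℚ) ∈ Set.range W.xSqClass :=
    ⟨0, by rw [xSqClass_zero, Int.cast_one]; exact ((sqClass_eq_one_iff one_ne_zero).mpr ⟨1, by norm_num⟩).symm⟩
  have hs7 : sqClass (((7 : ℤ)) : ℚ) ∈ Set.range W.xSqClass := by
    refine ⟨W.twoTorsionPoint, ?_⟩
    rw [xSqClass_twoTorsionPoint, show W.a₄ = (((7 * 5624 ^ 2 : ℤ)) : ℚ) by rw [hW]; norm_num,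
      sqClass_mul_sq_intCast (by norm_num) (by norm_num)]
  have hs518 : sqClass (((518 : ℤ)) : ℚ) ∈ Set.range W.xSqClass := by
    have h := sqClass_mem_range_of_eq (a := -29526) (b := 221405632) (x := 8288) (y := 613312) (by norm_num) (by norm_num)
    rwa [show (8288 : ℚ) = 518 * (4) ^ 2 by norm_num, sqClass_mul (by norm_num) (by norm_num), sqClass_sq, mul_one,
      show (518 : ℚ) = ((518 : ℤ) : ℚ) by norm_num] at h
  have hs74 : sqClass (((74 : ℤ)) : ℚ) ∈ Set.range W.xSqClass := by
    have h := mul_mem_range_xSqClass W hs7 hs518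
    rwa [← sqClass_mul (by norm_num) (by norm_num), ← Int.cast_mul, show ((7 : ℤ) * 518 : ℤ) = 74 * 7 ^ 2 by norm_num,
      sqClass_mul_sq_intCast (by norm_num) (by norm_num)] at h
  have hsqf : ∀ d ∈ ({1, 7, 518, 74} : Finset ℤ), Squarefree d := by
    intro d hd
    simp only [Finset.mem_insert, Finset.mem_singleton] at hd
    rcases hd with rfl | rfl | rfl | rfl <;> exact squarefree_int_of_natAbs rfl (by norm_num) (by simp)
  refine ⟨({1, 7, 518, 74} : Finset ℤ).image fun d : ℤ => sqClass (d : ℚ), ?_, ?_⟩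
  · intro c hc
    obtain ⟨d, hd, rfl⟩ := Finset.mem_image.mp (Finset.mem_coe.mp hc)
    simp only [Finset.mem_insert, Finset.mem_singleton] at hd
    rcases hd with rfl | rfl | rfl | rfl <;> assumption
  · rw [Finset.card_image_of_injOn (fun d₁ h₁ d₂ h₂ he => eq_of_sqClass_intCast_eq (hsqf d₁ h₁) (hsqf d₂ h₂) he)]
    rfl

/-- **Eight classes in `ᾱ(E′(ℚ))`**, `E′ = [0, 59052, 0, -13837852, 0]`: `[1]`, `ᾱ(T′) = [-13837852] = [−7]`, `ᾱ(-6327, 1482627) = [-703]`; `ᾱ(666, 131424) = [74]` and the products — the classes of `[1, -7, -703, 74, 4921, -518, -38, 266]` (points: kit j333313). [cite: SilvermanTate2015, §3.5–§3.6] -/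
theorem eight_classes_E'_19_37 :
    ∃ S : Finset (SqUnits ℚ), (S : Set (SqUnits ℚ)) ⊆ Set.range (⟨0, 59052, 0, -13837852, 0⟩ : WeierstrassCurve ℚ).xSqClass ∧ S.card = 8 := by
  haveI := isElliptic_E'_19_37
  set W := (⟨0, 59052, 0, -13837852, 0⟩ : WeierstrassCurve ℚ) with hW
  have hs1 : sqClass (((1 : ℤ)) : ℚ) ∈ Set.range W.xSqClass :=
    ⟨0, by rw [xSqClass_zero, Int.cast_one]; exact ((sqClass_eq_one_iff one_ne_zero).mpr ⟨1, by norm_num⟩).symm⟩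
  have hsm7 : sqClass (((-7 : ℤ)) : ℚ) ∈ Set.range W.xSqClass := by
    refine ⟨W.twoTorsionPoint, ?_⟩
    rw [xSqClass_twoTorsionPoint, show W.a₄ = (((-7 * 1406 ^ 2 : ℤ)) : ℚ) by rw [hW]; norm_num,
      sqClass_mul_sq_intCast (by norm_num) (by norm_num)]
  have hsm703 : sqClass (((-703 : ℤ)) : ℚ) ∈ Set.range W.xSqClass := by
    have h := sqClass_mem_range_of_eq (a := 59052) (b := -13837852) (x := (-6327)) (y := 1482627) (by norm_num) (by norm_num)
    rwa [show (-6327 : ℚ) = -703 * (3) ^ 2 by norm_num, sqClass_mul (by norm_num) (by norm_num), sqClass_sq, mul_one,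
      show (-703 : ℚ) = ((-703 : ℤ) : ℚ) by norm_num] at h
  have hs74 : sqClass (((74 : ℤ)) : ℚ) ∈ Set.range W.xSqClass := by
    have h := sqClass_mem_range_of_eq (a := 59052) (b := -13837852) (x := 666) (y := 131424) (by norm_num) (by norm_num)
    rwa [show (666 : ℚ) = 74 * (3) ^ 2 by norm_num, sqClass_mul (by norm_num) (by norm_num), sqClass_sq, mul_one,
      show (74 : ℚ) = ((74 : ℤ) : ℚ) by norm_num] at h
  have hs4921 : sqClass (((4921 : ℤ)) : ℚ) ∈ Set.range W.xSqClass := by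
    have h := mul_mem_range_xSqClass W hsm7 hsm703
    rwa [← sqClass_mul (by norm_num) (by norm_num), ← Int.cast_mul, show ((-7 : ℤ) * -703 : ℤ) = 4921 by norm_num] at h
  have hsm518 : sqClass (((-518 : ℤ)) : ℚ) ∈ Set.range W.xSqClass := by
    have h := mul_mem_range_xSqClass W hsm7 hs74
    rwa [← sqClass_mul (by norm_num) (by norm_num), ← Int.cast_mul, show ((-7 : ℤ) * 74 : ℤ) = -518 by norm_num] at h
  have hsm38 : sqClass (((-38 : ℤ)) : ℚ) ∈ Set.range W.xSqClass := by
    have h := mul_mem_range_xSqClass W hsm703 hs74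
    rwa [← sqClass_mul (by norm_num) (by norm_num), ← Int.cast_mul, show ((-703 : ℤ) * 74 : ℤ) = -38 * 37 ^ 2 by norm_num,
      sqClass_mul_sq_intCast (by norm_num) (by norm_num)] at h
  have hs266 : sqClass (((266 : ℤ)) : ℚ) ∈ Set.range W.xSqClass := by
    have h := mul_mem_range_xSqClass W hsm7 hsm38
    rwa [← sqClass_mul (by norm_num) (by norm_num), ← Int.cast_mul, show ((-7 : ℤ) * -38 : ℤ) = 266 by norm_num] at h
  have hsqf : ∀ d ∈ ({1, -7, -703, 74, 4921, -518, -38, 266} : Finset ℤ), Squarefree d := by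
    intro d hd
    simp only [Finset.mem_insert, Finset.mem_singleton] at hd
    rcases hd with rfl | rfl | rfl | rfl | rfl | rfl | rfl | rfl <;> exact squarefree_int_of_natAbs rfl (by norm_num) (by simp)
  refine ⟨({1, -7, -703, 74, 4921, -518, -38, 266} : Finset ℤ).image fun d : ℤ => sqClass (d : ℚ), ?_, ?_⟩
  · intro c hc
    obtain ⟨d, hd, rfl⟩ := Finset.mem_image.mp (Finset.mem_coe.mp hc)
    simp only [Finset.mem_insert, Finset.mem_singleton] at hd
    rcases hd with rfl | rfl | rfl | rfl | rfl | rfl | rfl | rfl <;> assumption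
  · rw [Finset.card_image_of_injOn (fun d₁ h₁ d₂ h₂ he => eq_of_sqClass_intCast_eq (hsqf d₁ h₁) (hsqf d₂ h₂) he)]
    rfl

/-- **`3 ≤ rank E(ℚ)`** for `E = [0, -29526, 0, 221405632, 0]`, the two-torsion model of `49a1^{(−1406)}`, FACT-FREE: four classes in `α(E(ℚ))`, eight in `ᾱ(E′(ℚ))`, and `#α·#ᾱ = 2^{rank+2}` (the tree's `natCard_range_xSqClass_mul`, Silverman–Tate §3.6, through the planted-rank kernel `Rank2.add_le_mordellWeilRank_add_two_of_card_le`: `2 + 3 ≤ rank + 2`). PARI's `ellrank` returns `[3, 3, 0]` (rank exactly `3`); the upper bound is not re-proved here. [cite: SilvermanTate2015, §3.6 (2^r = #α(Γ)·#ᾱ(Γ̄)/4)] -/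
theorem three_le_mordellWeilRank_E_19_37 : 3 ≤ (⟨0, -29526, 0, 221405632, 0⟩ : WeierstrassCurve ℚ).mordellWeilRank := by
  haveI := isElliptic_E_19_37
  obtain ⟨S, hS, hS4⟩ := four_classes_E_19_37
  obtain ⟨S', hS', hS8⟩ := eight_classes_E'_19_37
  have hcod : (⟨0, -29526, 0, 221405632, 0⟩ : WeierstrassCurve ℚ).twoIsogenyCodomain = ⟨0, 59052, 0, -13837852, 0⟩ := by
    simp only [twoIsogenyCodomain]; norm_num
  rw [← hcod] at hS'
  have h := add_le_mordellWeilRank_add_two_of_card_le _ hS hS' (i := 2) (j := 3) (by rw [hS4]; norm_num) (by rw [hS8]; norm_num)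
  omega

/-- **`3 ≤ rank W(ℚ)` for EVERY model `W` of `49a1^{(−2·19·37)}`** (`C • W = cm7^{(−1406)}` in the capstone's spelling `−(2·q·p)`, `q p : ℕ`): the two-torsion model `E = [0, -29526, 0, 221405632, 0]` is `(⟨(mk0 2)⁻¹, 2d, 0, 0⟩ * C) • W` (the lane's `smul_eq_twoTorsionModel_of_smul_eq_quadraticTwist`, `d = −1406`, as in `rank_le_one_and_sha_two_twoPrimesTwist`) and the rank is invariant under the change of variables (`mordellWeilRank_variableChange_holds`). [cite: SilvermanAEC2009, III.3.1(b) and VIII.6] [cite: SilvermanTate2015, §3.6] -/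
theorem three_le_mordellWeilRank_twoPrimesTwist_19_37 (W : WeierstrassCurve ℚ) [W.IsElliptic] (C : VariableChange ℚ)
    (hC : C • W = cm7.quadraticTwist (-(2 * ((19 : ℕ) : ℚ) * ((37 : ℕ) : ℚ)))) : 3 ≤ W.mordellWeilRank := by
  have hC' : C • W = cm7.quadraticTwist (((-1406 : ℤ)) : ℚ) := by
    rw [hC]; congr 1; push_cast; norm_num
  have hE := (smul_eq_twoTorsionModel_of_smul_eq_quadraticTwist (-1406) W C hC').trans
    (show (⟨0, ((21 * (-1406) : ℤ) : ℚ), 0, ((112 * (-1406) ^ 2 : ℤ) : ℚ), 0⟩ : WeierstrassCurve ℚ) = ⟨0, -29526, 0, 221405632, 0⟩ by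
      ext <;> push_cast <;> norm_num)
  have hrk := mordellWeilRank_variableChange_holds W
    ((⟨(Units.mk0 (2 : ℚ) two_ne_zero)⁻¹, 2 * (((-1406 : ℤ)) : ℚ), 0, 0⟩ : VariableChange ℚ) * C)
  unfold mordellWeilRank_variableChange at hrk
  rw [← hrk, hE]
  exact three_le_mordellWeilRank_E_19_37

end Witness_19_37

end Summit.BirchSwinnertonDyer.BirchSwinnertonDyer.Theorems.GoldfeldGoodTwists

end
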